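import Mathlib
import Literature.AlgebraicGeometry.Resolution.CobordantGame
import Literature.AlgebraicGeometry.Resolution.CobordantChartCoefficients
import Literature.AlgebraicGeometry.Resolution.FormalCoordinateChange
import Summits.ResolutionOfSingularities.ResolutionOfSingularities.Theorems.WeightedInvariantGlobalizeLocalDropCanonize
import Summits.ResolutionOfSingularities.ResolutionOfSingularities.Theorems.WeightedInvariantGlobalizeLocalDropCylinder
import Summits.ResolutionOfSingularities.ResolutionOfSingularities.Theorems.WeightedInvariantGlobalizeLocalDropRegularGerms
import Summits.ResolutionOfSingularities.ResolutionOfSingularities.Theorems.WeightedInvariantLocalWeightedDropUnitRoot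
import Summits.ResolutionOfSingularities.ResolutionOfSingularities.Theorems.WeightedInvariantLocalWeightedDropSliceCyl
import Summits.ResolutionOfSingularities.ResolutionOfSingularities.Theorems.WeightedInvariantLocalWeightedDropTameSliceKappa

/-!
# Plane assembly: the five plane statements win every singular plane germ

Crux `LocalWeightedDrop` (stmt-ResolutionOfSingularities-8899, route
ResolutionOfSingularities/WeightedInvariant), line `hasse-ridge-face-selection`, registered stub
`stub_planeAssembly` of the skeleton `LocalWeightedDrop` (statement verbatim from the registration).
It is the glue of the plane case: an IMPLICATION whose five hypotheses are the statements of the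
sibling plane stubs

* (A) pure powers `u · L^d` of smooth germs are won with value `0` (every dimension);
* (B1) contact `≥ N` for every `N` ⇒ `f = u·L^d + R` with `ord R ≥ N`, for every `N`;
* (B2) such approximations for every `N` ⇒ `f = u·L^d` exactly;
* (C) prepared (normalised) maximal-contact coordinates over an infinite field;
* (D) the face drop: from prepared coordinates with contact `≥ N` but not `≥ N + 1`, under the move
  `(X, (1, N))` every singular `s`-saturated successor `G` has `c₀ ≠ 0` and flat slice
  `G|_{y₀ = 0}` of order `< d`;

and whose conclusion is that every singular `f ∈ k[[x,y]]` over an algebraically closed field is in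
the winning region `CobordantGame.Won k 2 f` of the local weighted resolution game.

Proof (strong induction on the order `d ≥ 2` of `f`).
* If `f = u·L^d` is a pure power, (A) wins it in one move (`WonBy 0 ⇒ Won`).
* Otherwise the contact numbers are bounded: if every `N` had contact coordinates, (B1) and (B2)
  would make `f` a pure power.  Contact `≥ 0` and `≥ 1` hold in the identity coordinates (the
  `(1,1)`-weighted order is the order `d`), so the least failing contact number is `N + 1` with
  `N ≥ 1`, and (C) (an algebraically closed field is infinite) supplies prepared coordinates `Φ` of
  contact `≥ N`; maximality says `g := f∘Φ` does not have contact `≥ N + 1` in its own coordinates.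
* By coordinate invariance of the winning region (`won_subst_iff`) it suffices to win `g`; play the
  move `(X, (1, N))` (legal: `linMat_X_eq_one`).  A singular successor `G` at the exceptional point
  `c` satisfies `g(chart) = sᵃ·G` for the literal chart `CobordantChart.chart (1,N) c`
  (`cruxChart_eq_chart`; both weights are positive), so (D) gives `c₀ ≠ 0` and
  `ord (G|_{y₀ = 0}) < d`.
* The slot `0` has weight `1`, tame in every characteristic: `stub_unitRoot` (with `m = 1`),
  `stub_tameSliceKappa` and `stub_sliceCyl` write `G = u' · Φ'(cyl H)` with `u'` a unit, `Φ'` a legal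
  coordinate change and `H = G|_{y₀ = 0} ∈ k[[s, y₁]]` the flat slice.  `H` is won: if singular, by the
  induction hypothesis (its order is `< d`); if not, with value `0` (`wonBy_zero_of_not_isSingular`).
  Hence `G` is won by the monotonicities `won_cyl`, `won_subst_iff`, `won_unit_mul_iff`.
-/

set_option linter.dupNamespace false -- mandated namespace of this single-conjunct summit

namespace Summit.ResolutionOfSingularities.ResolutionOfSingularities.Theorems

open Literature.AlgebraicGeometry.Resolution
open Literature.AlgebraicGeometry.Resolution.CobordantGame

namespace PlaneAssembly

variable {k : Type} [Field k]

/-- The weight vector `(1, 1)` on `Fin 2` is the constant weight `1`. -/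
theorem vec_one_one_eq : (![1, 1] : Fin 2 → ℕ) = fun _ => 1 := by
  funext i
  fin_cases i <;> rfl

/-- The `(1,1)`-weighted order of a plane germ is its order. -/
theorem weightedOrder_one_one (f : MvPowerSeries (Fin 2) k) :
    MvPowerSeries.weightedOrder ![1, 1] f = f.order := by
  rw [vec_one_one_eq]
  rfl

/-- The identity coordinates `X` have contact `≥ N` for `N = 0` and `N = 1` with any germ of order
`d`: the `(1,N)`-weighted order of `f = f∘X` is `≥ N·d`. -/
theorem contact_X_of_le_one (f : MvPowerSeries (Fin 2) k) {d N : ℕ} (hfd : f.order = d) (hN : N ≤ 1) :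
    ∃ Φ : Fin 2 → MvPowerSeries (Fin 2) k, (∀ i, MvPowerSeries.constantCoeff (Φ i) = 0) ∧
      IsUnit (Matrix.det (Matrix.of fun i j => MvPowerSeries.coeff (Finsupp.single j 1) (Φ i))) ∧
      ((N * d : ℕ) : ℕ∞) ≤ MvPowerSeries.weightedOrder ![1, N] (MvPowerSeries.subst Φ f) := by
  refine ⟨MvPowerSeries.X, fun i => MvPowerSeries.constantCoeff_X i, ?_, ?_⟩
  · rw [linMat_X_eq_one, Matrix.det_one]
    exact isUnit_one
  · rw [MvPowerSeries.subst_self, id]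
    rcases Nat.le_one_iff_eq_zero_or_eq_one.mp hN with rfl | rfl
    · simp
    · rw [weightedOrder_one_one, hfd, one_mul]

/-- The crux's chart family for the weights `(1, N)` with `N ≥ 1` (both positive) is the literal
chart `CobordantChart.chart (1, N) c` at the same point. -/
theorem cruxChart_one_eq_chart {N : ℕ} (hN : 1 ≤ N) (c : Fin 2 → k) :
    cruxChart k ![1, N] c = CobordantChart.chart ![1, N] c := by
  have h := CobordantChart.cruxChart_eq_chart (k := k) ![1, N] c
  have hc : (fun i => if 0 < (![1, N] : Fin 2 → ℕ) i then c i else 0) = c := by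
    funext i
    fin_cases i
    · simp
    · have hN' : 0 < N := hN
      simp [hN']
  rw [hc] at h
  exact h

/-- THE TAME SLICE AT SLOT `0` OF WEIGHT `1` wins the successor from its flat slice: if
`F(chart (1,N) c) = sᵃ · G` with `c₀ ≠ 0`, and the flat slice `H = G|_{y₀ = 0} ∈ k[[s, y₁]]` is won,
then `G` is won — `G = u · Φ'(cyl H)` by `stub_unitRoot`/`stub_tameSliceKappa`/`stub_sliceCyl`, and the
winning region is monotone under cylinders, legal coordinate changes and units. -/
theorem won_of_won_slice {N : ℕ} (hN : 1 ≤ N) (F : MvPowerSeries (Fin 2) k) (c : Fin 2 → k) (a : ℕ)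
    (G : MvPowerSeries (Fin 3) k)
    (hfac : MvPowerSeries.subst (CobordantChart.chart ![1, N] c) F = MvPowerSeries.X 0 ^ a * G)
    (hc0 : c 0 ≠ 0)
    (hH : Won k 2 (MvPowerSeries.subst
      (fun j : Fin 3 => if j = (0 : Fin 2).succ then (0 : MvPowerSeries (Fin 2) k)
        else MvPowerSeries.X (Fin.predAbove (0 : Fin 2) j)) G)) :
    Won k 3 G := by
  have hconv : ∀ i, (![1, N] : Fin 2 → ℕ) i = 0 → c i = 0 := by
    intro i hi
    exfalso
    fin_cases i
    · simp at hi
    · have : N = 0 := by simpa using hi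
      omega
  have h1 : ((1 : ℕ) : k) ≠ 0 := by
    rw [Nat.cast_one]
    exact one_ne_zero
  obtain ⟨r, hr1, hrw, hrsupp⟩ := stub_unitRoot k 2 (0 : Fin 2).succ 1 h1 (c 0) hc0
  have hrw' : r ^ ((![1, N] : Fin 2 → ℕ) 0) =
      1 + MvPowerSeries.C (c 0)⁻¹ * MvPowerSeries.X (0 : Fin 2).succ := by
    rw [show (![1, N] : Fin 2 → ℕ) 0 = 1 from rfl]
    exact hrw
  obtain ⟨Φ, u, hΦ0, hΦdet, hu, hGeq⟩ :=
    stub_tameSliceKappa k 2 F ![1, N] c hconv a G hfac 0 hc0 r hr1 hrw' hrsupp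
  rw [← stub_sliceCyl k 2 0 G] at hGeq
  have hW1 := won_cyl (k := k) ((0 : Fin 2).succ) hH
  have hW2 := (won_subst_iff hΦ0 hΦdet _).mpr hW1
  have hW3 := (won_unit_mul_iff hu _).mpr hW2
  rw [hGeq]
  exact hW3

end PlaneAssembly

open PlaneAssembly in
/-- PLANE ASSEMBLY (the lead's glue, registered as a stub so that the composition checks now): the five
plane statements above imply that every singular plane germ over an algebraically closed field is WON —
by strong induction on the order `d`, with the move read off the dichotomy "pure `d`-th power (one
divisorial move) / bounded contact (the face-selected move `(1, N)` in prepared maximal-contact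
coordinates drops the order of the tame flat slice at every singular successor, and the successor is a
unit times a coordinate change of the cylinder over that slice)". -/
theorem stub_planeAssembly :
    (∀ (k : Type) [Field k] (n : ℕ) (u L : MvPowerSeries (Fin (n + 1)) k) (d : ℕ),
      MvPowerSeries.constantCoeff u ≠ 0 → MvPowerSeries.constantCoeff L = 0 →
      (∃ i, MvPowerSeries.coeff (Finsupp.single i 1) L ≠ 0) →
      CobordantGame.WonBy k 0 (n + 1) (u * L ^ d)) →
    (∀ (k : Type) [Field k] (f : MvPowerSeries (Fin 2) k) (d : ℕ), f.order = d →
      (∀ N : ℕ, ∃ Φ : Fin 2 → MvPowerSeries (Fin 2) k, (∀ i, MvPowerSeries.constantCoeff (Φ i) = 0) ∧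
        IsUnit (Matrix.det (Matrix.of fun i j => MvPowerSeries.coeff (Finsupp.single j 1) (Φ i))) ∧
        ((N * d : ℕ) : ℕ∞) ≤ MvPowerSeries.weightedOrder ![1, N] (MvPowerSeries.subst Φ f)) →
      ∀ N : ℕ, ∃ (u L R : MvPowerSeries (Fin 2) k), MvPowerSeries.constantCoeff u ≠ 0 ∧
        MvPowerSeries.constantCoeff L = 0 ∧ (∃ i, MvPowerSeries.coeff (Finsupp.single i 1) L ≠ 0) ∧
        f = u * L ^ d + R ∧ ((N : ℕ) : ℕ∞) ≤ R.order) →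
    (∀ (k : Type) [Field k] (f : MvPowerSeries (Fin 2) k) (d : ℕ), f.order = d →
      (∀ N : ℕ, ∃ (u L R : MvPowerSeries (Fin 2) k), MvPowerSeries.constantCoeff u ≠ 0 ∧
        MvPowerSeries.constantCoeff L = 0 ∧ (∃ i, MvPowerSeries.coeff (Finsupp.single i 1) L ≠ 0) ∧
        f = u * L ^ d + R ∧ ((N : ℕ) : ℕ∞) ≤ R.order) →
      ∃ (u L : MvPowerSeries (Fin 2) k), MvPowerSeries.constantCoeff u ≠ 0 ∧
        MvPowerSeries.constantCoeff L = 0 ∧ (∃ i, MvPowerSeries.coeff (Finsupp.single i 1) L ≠ 0) ∧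
        f = u * L ^ d) →
    (∀ (k : Type) [Field k] [Infinite k] (f : MvPowerSeries (Fin 2) k) (d N : ℕ),
      f.order = d → 1 ≤ d → 1 ≤ N →
      (∃ Φ : Fin 2 → MvPowerSeries (Fin 2) k, (∀ i, MvPowerSeries.constantCoeff (Φ i) = 0) ∧
        IsUnit (Matrix.det (Matrix.of fun i j => MvPowerSeries.coeff (Finsupp.single j 1) (Φ i))) ∧
        ((N * d : ℕ) : ℕ∞) ≤ MvPowerSeries.weightedOrder ![1, N] (MvPowerSeries.subst Φ f)) →
      ∃ Φ : Fin 2 → MvPowerSeries (Fin 2) k, (∀ i, MvPowerSeries.constantCoeff (Φ i) = 0) ∧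
        IsUnit (Matrix.det (Matrix.of fun i j => MvPowerSeries.coeff (Finsupp.single j 1) (Φ i))) ∧
        (MvPowerSeries.subst Φ f).order = d ∧
        ((N * d : ℕ) : ℕ∞) ≤ MvPowerSeries.weightedOrder ![1, N] (MvPowerSeries.subst Φ f) ∧
        MvPowerSeries.coeff (Finsupp.single 1 d) (MvPowerSeries.subst Φ f) ≠ 0 ∧
        ∀ (a β : k), a ≠ 0 → ∃ j, j ≤ d ∧
          MvPowerSeries.coeff (Finsupp.single 0 (N * (d - j)) + Finsupp.single 1 j) (MvPowerSeries.subst Φ f) ≠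
            β * (d.choose j : k) * (-a) ^ (d - j)) →
    (∀ (k : Type) [Field k] (g : MvPowerSeries (Fin 2) k) (d N : ℕ),
      g.order = d → 2 ≤ d → 1 ≤ N →
      ((N * d : ℕ) : ℕ∞) ≤ MvPowerSeries.weightedOrder ![1, N] g →
      MvPowerSeries.weightedOrder ![1, N + 1] g < (((N + 1) * d : ℕ) : ℕ∞) →
      MvPowerSeries.coeff (Finsupp.single 1 d) g ≠ 0 →
      (∀ (a β : k), a ≠ 0 → ∃ j, j ≤ d ∧
        MvPowerSeries.coeff (Finsupp.single 0 (N * (d - j)) + Finsupp.single 1 j) g ≠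
          β * (d.choose j : k) * (-a) ^ (d - j)) →
      ∀ (c : Fin 2 → k) (a : ℕ) (G : MvPowerSeries (Fin 3) k), (∃ i, c i ≠ 0) →
        MvPowerSeries.subst (CobordantChart.chart ![1, N] c) g = MvPowerSeries.X 0 ^ a * G →
        ¬ (MvPowerSeries.X (0 : Fin 3) ∣ G) →
        (MvPowerSeries.constantCoeff G = 0 ∧ ∀ j, MvPowerSeries.coeff (Finsupp.single j 1) G = 0) →
        c 0 ≠ 0 ∧ MvPowerSeries.order (MvPowerSeries.subst
          (fun j : Fin 3 => if j = (0 : Fin 2).succ then (0 : MvPowerSeries (Fin 2) k)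
            else MvPowerSeries.X (Fin.predAbove (0 : Fin 2) j)) G) < (d : ℕ∞)) →
    ∀ (k : Type) [Field k] [IsAlgClosed k] (f : MvPowerSeries (Fin 2) k),
      CobordantGame.IsSingular k f → CobordantGame.Won k 2 f := by
  intro hA hB1 hB2 hC hD k _ _ f hf
  classical
  -- strong induction on the order `d` of the singular germ `f`
  suffices key : ∀ (d : ℕ) (f : MvPowerSeries (Fin 2) k), IsSingular k f → f.order = d → Won k 2 f by
    obtain ⟨d, hd⟩ := ENat.ne_top_iff_exists.mp (fun h => hf.1 (MvPowerSeries.order_eq_top_iff.mp h))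
    exact key d f hf hd.symm
  intro d
  induction d using Nat.strong_induction_on with
  | _ d ih =>
  intro f hf hfd
  have h2d : 2 ≤ d := by
    have h2 : (2 : ℕ∞) ≤ f.order := (FormalCoordChange.two_le_order_iff f).mpr ⟨hf.2.1, hf.2.2⟩
    rw [hfd] at h2
    exact_mod_cast h2
  -- PURE CASE: `f = u · L^d` is won in one move by (A)
  by_cases hpure : ∃ u L : MvPowerSeries (Fin 2) k, MvPowerSeries.constantCoeff u ≠ 0 ∧
      MvPowerSeries.constantCoeff L = 0 ∧ (∃ i, MvPowerSeries.coeff (Finsupp.single i 1) L ≠ 0) ∧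
      f = u * L ^ d
  · obtain ⟨u, L, hu, hL0, hL1, rfl⟩ := hpure
    exact (hA k 1 u L d hu hL0 hL1).won
  -- BOUNDED CONTACT: some contact number fails, by (B1) + (B2)
  have hex : ∃ N : ℕ, ¬ ∃ Φ : Fin 2 → MvPowerSeries (Fin 2) k,
      (∀ i, MvPowerSeries.constantCoeff (Φ i) = 0) ∧
      IsUnit (Matrix.det (Matrix.of fun i j => MvPowerSeries.coeff (Finsupp.single j 1) (Φ i))) ∧
      ((N * d : ℕ) : ℕ∞) ≤ MvPowerSeries.weightedOrder ![1, N] (MvPowerSeries.subst Φ f) := by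
    by_contra h
    push Not at h
    exact hpure (hB2 k f d hfd (hB1 k f d hfd h))
  -- the least failing contact number is `N + 1` with `N ≥ 1`
  obtain ⟨N, hN1, hSN, hNS⟩ : ∃ N : ℕ, 1 ≤ N ∧
      (∃ Φ : Fin 2 → MvPowerSeries (Fin 2) k, (∀ i, MvPowerSeries.constantCoeff (Φ i) = 0) ∧
        IsUnit (Matrix.det (Matrix.of fun i j => MvPowerSeries.coeff (Finsupp.single j 1) (Φ i))) ∧
        ((N * d : ℕ) : ℕ∞) ≤ MvPowerSeries.weightedOrder ![1, N] (MvPowerSeries.subst Φ f)) ∧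
      ¬ ∃ Φ : Fin 2 → MvPowerSeries (Fin 2) k, (∀ i, MvPowerSeries.constantCoeff (Φ i) = 0) ∧
        IsUnit (Matrix.det (Matrix.of fun i j => MvPowerSeries.coeff (Finsupp.single j 1) (Φ i))) ∧
        (((N + 1) * d : ℕ) : ℕ∞) ≤ MvPowerSeries.weightedOrder ![1, N + 1] (MvPowerSeries.subst Φ f) := by
    set M := Nat.find hex with hMdef
    have hM : ¬ _ := Nat.find_spec hex
    have hMmin : ∀ m, m < M → _ := fun m hm => not_not.mp (Nat.find_min hex hm)
    have hM2 : 2 ≤ M := by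
      by_contra hlt
      push Not at hlt
      exact hM (contact_X_of_le_one f hfd (by omega))
    refine ⟨M - 1, by omega, hMmin (M - 1) (by omega), ?_⟩
    rw [show M - 1 + 1 = M by omega]
    exact hM
  -- PREPARE: normalised maximal-contact coordinates `Φ` by (C); `g := f∘Φ`
  obtain ⟨Φ, hΦ0, hΦdet, hgd, hcontact, had, hnorm⟩ := hC k f d N hfd (by omega) hN1 hSN
  have hmax : MvPowerSeries.weightedOrder ![1, N + 1] (MvPowerSeries.subst Φ f) <
      (((N + 1) * d : ℕ) : ℕ∞) :=
    not_le.mp fun hle => hNS ⟨Φ, hΦ0, hΦdet, hle⟩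
  -- it suffices to win `g`, by coordinate invariance of the winning region
  refine (won_subst_iff hΦ0 hΦdet f).mp ?_
  -- THE MOVE `(X, (1, N))` on `g`
  refine Won.move MvPowerSeries.X ![1, N] ⟨fun i => MvPowerSeries.constantCoeff_X i,
    by rw [linMat_X_eq_one, Matrix.det_one]; exact isUnit_one, ⟨0, by simp⟩⟩ ?_
  rintro G ⟨c, a, ⟨i, -, hci⟩, hfac, hndvd, hsing⟩
  rw [cruxChart_one_eq_chart hN1 c, MvPowerSeries.subst_self, id] at hfac
  -- FACE DROP by (D): `c₀ ≠ 0` and the flat slice has order `< d`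
  obtain ⟨hc0, hord⟩ := hD k (MvPowerSeries.subst Φ f) d N hgd h2d hN1 hcontact hmax had hnorm c a G
    ⟨i, hci⟩ hfac hndvd hsing
  -- WIN THE SLICE by induction (or outright if it is not singular), then climb back
  refine won_of_won_slice hN1 (MvPowerSeries.subst Φ f) c a G hfac hc0 ?_
  set H : MvPowerSeries (Fin 2) k := MvPowerSeries.subst
    (fun j : Fin 3 => if j = (0 : Fin 2).succ then (0 : MvPowerSeries (Fin 2) k)
      else MvPowerSeries.X (Fin.predAbove (0 : Fin 2) j)) G with hHdef
  by_cases hHs : IsSingular k H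
  · obtain ⟨d', hd'⟩ := ENat.ne_top_iff_exists.mp
      (fun h => hHs.1 (MvPowerSeries.order_eq_top_iff.mp h))
    have hlt : d' < d := by
      rw [← hd'] at hord
      exact_mod_cast hord
    exact ih d' hlt H hHs hd'.symm
  · exact (wonBy_zero_of_not_isSingular (by norm_num) hHs).won

end Summit.ResolutionOfSingularities.ResolutionOfSingularities.Theorems
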